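import Summits.BirchSwinnertonDyer.BirchSwinnertonDyer.Theorems.GenusKolyvaginAtTwoMinimalTwinBSDTwoSwappedPairOneBit
import Summits.BirchSwinnertonDyer.BirchSwinnertonDyer.Theorems.GenusKolyvaginAtTwoMinimalTwinBSDTwoSwappedPairDescent
import Summits.BirchSwinnertonDyer.BirchSwinnertonDyer.Theorems.Rank1ResidualX5TwoDefs
import HarnessLib

/-!
# Route `GenusKolyvaginAtTwo`, crux U₂ `MinimalTwinBSDTwo` (stmt-BirchSwinnertonDyer-22985): THE `ε = −1` DESCENT AT DEPTH
# `M₀ = ord₂ c + ord₂ C(E)` ON `Δ < 0` (Manin-free, Tamagawa-general) — an engine of LINE 23's shape for the cell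
# `hTw1 = (Δ < 0, ord₂ C = 1)` that `closes` consumes, and its losslessness (the BSD pair forces the depth)

Seat `bsd-line-gk2-p3` g28 (PROVER seat 3/3, cell `bsd-f1-sign2`), `--supports stmt-BirchSwinnertonDyer-22985` (helper; closes nothing).
THEOREMS ONLY (no definition, no named fact, no `sorry`); standard axioms.  **BSD is NOT proved by this file; U₂ / hTw / hTw1 are NOT
proved; no item is closed.**  §1–§2 are CONDITIONAL (D-0014) on the four STATEMENT-ONLY published facts the route already carries as items —
Gross–Zagier at every level (`gross_zagier`, item 24148), Gross–Zagier–Kolyvagin (`rank_eq_analyticRank_of_analyticRank_le_one`, 19921),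
modularity (`hasEntireLFunction_rat`, 19273), Milne 1972 any-model (`Milne1972.bsdQuotient_baseChange_quadratic_anyModel`, 24149) — exactly as
gk2-p2 g23's S3′ (`TwinSwap.swappedPairDescentAtTwo_depthZero_of_facts`, p764815), whose proof this file re-runs at positive depth.

THE CELL.  `closes` applies U₂ only on `hTw0 = (Δ > 0, ord₂ C = 0)` and `hTw1 = (Δ < 0, ord₂ C = 1)` (this seat's `…TamagawaSlices`,
p766209).  LINE 23 «twin_swap» v1.2 serves `hTw0` (odd `C(E)`, depth-zero witness `y_K ∉ 2E(K[1])`); on `hTw1` that witness is BSD-inconsistent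
(`…SwappedPairHeegnerIndex` §3: `2 ∣ C(E)` forces `2 ∣ y_K`).  The right witness on `hTw1` is DEPTH ONE (for an odd-Manin datum), and in general DEPTH
`ord₂ c + ord₂ C(E)`: Gross–Zagier over `K` reads `#Ш_an(E_K) = (I/(c·C(E)))²` (`w_K = 2`; `C(E/K) = C(E)²`), and the swapped pair sandwich with
the one-bit budget (`…SwappedPairOneBit`, UNCONDITIONAL) gives `Ш(E/K)[2^∞] = 0`; so `BSD₂` over `K` is «`ord₂ I = ord₂ c + ord₂ C(E)`».  The
`c`-axis at `C(E)` odd is gk2-p2 g23's Manin-free S3″ (`swappedPairDescentAtTwo_maninExponent_of_facts`, p766443); this file adds the `C(E)`-axis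
(both at once), which is what the cell `hTw1` needs.

* §1 **`swappedPairDescentAtTwo_tamagawaDepth_of_facts`** — `GZ → GZK → modularity → Milne →` for `W/ℚ` globally minimal with `r_an(E) = 1`,
  `#Sel₂(E) = 2`, **`Δ_E < 0`, any `C(E)`**; `K` imaginary quadratic, `d_K` odd `≠ −3`, Heegner for `N_E`; ANY datum `Dt` (`Dt.c ≠ 0`); a
  conductor-`1` datum `d₁` with `P(1)` of infinite order and **`2^(ord₂ c + ord₂ C(E)) ∥ P(1)` in `E(K[1])`**; a globally minimal `2`-Selmer-TRIVIAL
  twin `Wd ≅ E^(d_K)` with the one-bit budget **`ord₂ C(Wd) ≤ ord₂ C(E) + 1`**: then **`BSD₂(Wd) → BSD₂(E)`** (`r_an(Wd) = 0` derived).  At `C(E)`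
  odd this is g23's S3′/S3″ on `Δ < 0`; at `ord₂ C(E) = 1` with `c` odd it is the engine for `hTw1` with the witness «`2 ∣ y_K`, `4 ∤ y_K`».
* §2 **`twoDivExponent_eq_padicValNat_tamagawa_of_bsdp`** — LOSSLESSNESS: on the same frame with ANY exact exponent `2^(M₀) ∥ P(1)`,
  `BSD₂(E) ∧ BSD₂(Wd)` + PRINT force **`M₀ = ord₂ c + ord₂ C(E)`**; `…_of_nonCMAtTwo`: the same from the leaf `NonCMAtTwo` (`E` non-CM of analytic
  rank `1`, the twin non-CM of analytic rank `0`).  So on `hTw1` the depth-one clause carries no slack, exactly as the depth-zero clause on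
  `hTw0` (g23 p765721 / this seat p766364).
* §3 **`hTw1_of_wall_of_reversedSupplyDepthOne_of_facts`** — NET for the planner-of-record (census, BY NAME): **`hTw1 ⟸ S1 (the
  rank-0 wall: BSD₂ of the 2-Selmer-trivial twin) + S2⁻ + PRINT`**, where S2⁻ :=
  «for `W` non-CM, `r_an = 1`, `#Sel₂ = 2`, `Δ < 0`, `ord₂ C(W) = 1`: some Heegner field `K` (`d_K` odd `≠ −3`), a datum `Dt` (any `c ≠ 0`),
  `y_K` of infinite order with `2^(ord₂ c + 1) ∥ y_K` in `E(K[1])`, and a globally minimal twin `Wd ≅ E^(d_K)` with `#Sel₂(Wd) = 1`,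
  `ord₂ C(Wd) ≤ 2`» — the reversed `2`-Selmer-trivial Heegner twin supply at depth one (the `Δ < 0` image of g23's Manin-free S2″; for prime
  `|d_K|` the budget is automatic, `ord₂ C(Wd) = 2`).  Beyond print in S2⁻: the joint Heegner + Sel₂-trivial + non-vanishing supply (as for
  S2″); the exponent clause is lossless (§2) and NO Manin-constant input is needed.  BSD is NOT proved; nothing is closed.

References: [GrossZagier1986] I.(6.3), V.§2 (2.2); [GrossLMS1991] §2 (2.2), §4, §5 Prop. 5.3; [McCallumLMS1991] §5 Lemma 5.1;
[Milne1972ArithmeticAV] §1 Thm. 1; [Kramer1981] Thm. 1, §2 Prop. 3; [Miller2011LMS] Def. 1.1.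
-/

set_option autoImplicit false
set_option linter.dupNamespace false -- `Summit.<P>.<Sub>` repeats `BirchSwinnertonDyer` (D-0017)

noncomputable section

open scoped Classical

open WeierstrassCurve NumberField Literature.NumberTheory.EllipticCurves
  Literature.NumberTheory.EllipticCurves.ModularForms
  Literature.NumberTheory.EllipticCurves.Rank1Residual
  Literature.NumberTheory.EllipticCurves.Rank1Residual.Typed
  Literature.NumberTheory.EllipticCurves.KrizLi2019
  Summit.BirchSwinnertonDyer.Rank1Residual
  Summit.BirchSwinnertonDyer.Rank1Residual.AdditivePotMult
  Summit.BirchSwinnertonDyer.BirchSwinnertonDyer.Rank1Residual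
  Summit.BirchSwinnertonDyer.BirchSwinnertonDyer.Theorems.CMExactDescent
  Summit.BirchSwinnertonDyer.BirchSwinnertonDyer.Theorems.GenusExact.TwinSwap

namespace Summit.BirchSwinnertonDyer.BirchSwinnertonDyer.Theorems.GenusExact.TwinSwap.OneBit

/-! ## §0 The shared computation: `ord₂ #Ш_an(E_K) = 2 M₀ − 2 ord₂ c − 2 ord₂ C(E)` and `ord₂ #Ш(E_K) = 0` on the one-bit swapped frame -/

/-- **The `2`-adic bookkeeping of the one-bit swapped frame.**  `W/ℚ` globally minimal with `r_an(E) = 1`, `#Sel₂(E) = 2`, `Δ_E < 0`; `K`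
imaginary quadratic, `d_K` odd `≠ −3`, Heegner for `N_E`; any datum `Dt` (`c ≠ 0`); `d₁` conductor-`1` with `2^(M₀) ∥ P(1)` in `E(K[1])`; `Wd` a
globally minimal `2`-Selmer-trivial twin with `ord₂ C(Wd) ≤ ord₂ C(E) + 1`; PRINT `hGZ` (for `(N_E, W, K)`), `hGZK`, `hmod`.  Then `r_an(Wd) = 0`,
and there is a rational `q` with `#Ш_an(E_K) = q`, **`ord₂ q = 2 M₀ − 2 ord₂ c − 2 ord₂ C(E)`**, and **`ord₂ #Ш(E_K) = 0`** (finite).  Gross–Zagier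
over `K` (`CMExactDescent.shaAnOverC_baseChange_eq_of_heegner`: `q = 4I²/(c² w_K² C(E)²)`, `w_K = 2`, `ord₂ I = M₀` by McCallum 5.1 over `K`
after Galois descent `K[1] → K`) and the one-bit swapped sandwich (`natCard_primaryComponent_sha_baseChange_two_eq_one_of_swappedPair_of_le_succ`,
UNCONDITIONAL).  [cite: GrossZagier1986, V.§2 (2.2)] [cite: McCallumLMS1991, §5 Lemma 5.1] [cite: Kramer1981, Thm. 1] -/
theorem padicValRat_shaAn_and_shaOrder_of_swappedPair_of_le_succ
    (W : WeierstrassCurve ℚ) [W.IsElliptic] [W.IsGloballyMinimal] [NeZero (W.conductorNorm ℤ)]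
    (K : Type) [Field K] [NumberField K]
    (hGZ : gross_zagier (W.conductorNorm ℤ) W K) (hGZK : rank_eq_analyticRank_of_analyticRank_le_one) (hmod : hasEntireLFunction_rat)
    (hr : W.analyticRank = 1) (hSel : Nat.card (W.selmerGroup 2) = 2) (hΔ : W.Δ < 0)
    (hK : IsImaginaryQuadratic K) (hodd : Odd (NumberField.discr K)) (h3 : NumberField.discr K ≠ -3)
    (hH : SatisfiesHeegnerHypothesis (W.conductorNorm ℤ) K)
    (Dt : ModularParametrizationData W (W.conductorNorm ℤ)) (hc0 : Dt.c ≠ 0) (β : ℤ) (ι : K →+* ℂ)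
    (d₁ : KolyvaginHeegnerData Dt β ι 1) (hy : ¬ IsOfFinAddOrder d₁.derivedPoint) {M₀ : ℕ}
    (hdiv : ∃ Q : (W.baseChange (ringClassField K ι 1)).toAffine.Point, ((2 ^ M₀ : ℕ) : ℤ) • Q = d₁.derivedPoint)
    (hndiv : ¬ ∃ Q : (W.baseChange (ringClassField K ι 1)).toAffine.Point, ((2 ^ (M₀ + 1) : ℕ) : ℤ) • Q = d₁.derivedPoint)
    (Wd : WeierstrassCurve ℚ) [Wd.IsElliptic] [Wd.IsGloballyMinimal]
    (Cd : VariableChange ℚ) (hCd : Cd • W.quadraticTwist (NumberField.discr K : ℚ) = Wd)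
    (hSel1 : Nat.card (Wd.selmerGroup 2) = 1)
    (hDEF : padicValNat 2 Wd.tamagawaProduct ≤ padicValNat 2 W.tamagawaProduct + 1) :
    Wd.analyticRank = 0 ∧ (W.baseChange K).analyticRank = 1 ∧ Finite (W.baseChange K).sha ∧
      padicValNat 2 (W.baseChange K).shaOrder = 0 ∧
      ∃ q : ℚ, shaAnOverC (W.baseChange K) = (q : ℂ) ∧
        padicValRat 2 q = 2 * (M₀ : ℤ) - 2 * (padicValInt 2 Dt.c : ℤ) - 2 * (padicValNat 2 W.tamagawaProduct : ℤ) := by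
  haveI : Fact (Nat.Prime 2) := ⟨Nat.prime_two⟩
  haveI hEK : (W.baseChange K).IsElliptic := isElliptic_baseChange' W K
  have h2 : Module.finrank ℚ K = 2 := hK.1
  have hD0 : (NumberField.discr K : ℚ) ≠ 0 := by exact_mod_cast NumberField.discr_ne_zero K
  haveI hEt : (W.quadraticTwist (NumberField.discr K : ℚ)).IsElliptic := W.isElliptic_quadraticTwist hD0
  obtain ⟨-, hDlt⟩ := discr_emod_four_and_lt_of_odd hK hodd h3
  have hw2 : Units.torsionOrder K = 2 :=
    Literature.NumberTheory.QuadraticFields.Quadratic.torsionOrder_eq_two_of_discr_lt_neg_four h2 hDlt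
  -- the Heegner point `P₀ ∈ E(K)` below `P(1)`
  obtain ⟨P₀, Hd, hP₀, hP₀K⟩ := exists_heegnerPoint_map_eq_derivedPoint_one hK hH d₁
  have hPinf : ¬ IsOfFinAddOrder P₀ := by
    intro hfin
    apply hy
    rw [← hP₀K]
    exact (WeierstrassCurve.Affine.Point.map (W' := W)
      (algebraMap K (ringClassField K ι 1)).toRatAlgHom).isOfFinAddOrder hfin
  -- ranks over `ℚ`: `rank E(K) ≥ 1`, `rank E^(d_K)(ℚ) = 0`, hence `rank E(ℚ) ≥ 1`
  haveI : Module.Finite ℤ (W.baseChange K).toAffine.Point := (W.baseChange K).module_finite_point_holds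
  have hK1 : 1 ≤ (W.baseChange K).mordellWeilRank :=
    Literature.NumberTheory.EllipticCurves.one_le_mordellWeilRank_of_not_isOfFinAddOrder (W.baseChange K) inferInstance hPinf
  have hSelT : Nat.card ((W.quadraticTwist (NumberField.discr K : ℚ)).selmerGroup ((2 : ℕ) : ℤ)) = 1 := by
    have h := natCard_selmerGroup_smul (W.quadraticTwist (NumberField.discr K : ℚ)) Cd (n := 2) two_ne_zero
    rw [hCd] at h
    rw [← h, Nat.cast_ofNat]
    exact hSel1
  obtain ⟨hrkT0, -, -⟩ := rank_eq_zero_and_torsionBy_eq_bot_and_sha_inf_torsionBy_eq_bot_of_natCard_selmerGroup_eq_one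
    (W.quadraticTwist (NumberField.discr K : ℚ)) 2 hSelT
  have hrk : 1 ≤ W.mordellWeilRank := by
    have hsum := W.mordellWeilRank_baseChange_of_finrank_eq_two_of_finite K h2
    rw [hrkT0, add_zero] at hsum
    rw [← hsum]
    exact hK1
  -- the ONE-BIT swapped pair sandwich: `Ш(E/K)[2^∞] = 0`, unconditionally
  obtain ⟨-, hsha⟩ := natCard_primaryComponent_sha_baseChange_two_eq_one_of_swappedPair_of_le_succ W K hΔ hK hodd hH hrk hSel Cd hCd
    hSel1 hDEF
  -- `E(ℚ)[2] = 0`, hence `E(K[1])[2^M] = 0` and `E(K)[2] = 0`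
  obtain ⟨-, hT2, -⟩ := rank_eq_one_and_sha_primary_eq_zero_of_natCard_selmerGroup_eq_two W hSel hrk
  have hT2' : ∀ P : W.toAffine.Point, 2 • P = 0 → P = 0 := fun P hP ↦ by convert hT2 P (by convert hP)
  have htor1 : ∀ (M : ℕ) (R : (W.baseChange (ringClassField K ι 1)).toAffine.Point),
      ((2 ^ M : ℕ) : ℤ) • R = 0 → R = 0 :=
    fun M R hR ↦ eq_zero_of_two_pow_smul_eq_zero_ringClassField_of_noTwoTorsion W hK hodd hH hT2' ι M R hR
  have hiv : ∀ x : (W.baseChange K).toAffine.Point, 2 • x = 0 → x = 0 := fun x hx ↦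
    forall_two_zsmul_baseChange_eq_zero_of_heegner W K hK hodd hH hT2' x (by rw [← natCast_zsmul] at hx; exact_mod_cast hx)
  -- analytic ranks
  have hrt : (W.quadraticTwist (NumberField.discr K : ℚ)).analyticRank = 0 :=
    analyticRank_twist_eq_zero_of_rankOne W K hGZ hmod hK hH hr ⟨Dt, Hd, ι, hP₀⟩ hPinf
  have hrd : Wd.analyticRank = 0 := by rw [← hCd, analyticRank_smul, hrt]
  have hrK : (W.baseChange K).analyticRank = 1 :=
    (P2.analyticRank_baseChange_eq_one_iff W K hmod h2).mpr (Or.inl ⟨hr, hrt⟩)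
  -- Gross–Zagier over `K`
  obtain ⟨hrkK, hShaK, -, hshaC⟩ := shaAnOverC_baseChange_eq_of_heegner W K Dt Hd ι P₀ hGZ hGZK hmod hK hH hP₀ hc0 hrK
  haveI hfinK : Finite (W.baseChange K).sha := hShaK
  -- `ord₂ [E(K) : ℤP₀] = M₀`
  have hdivK : ∃ Q : (W.baseChange K).toAffine.Point, ((2 ^ M₀ : ℕ) : ℤ) • Q = P₀ :=
    (X11b.Three.Koly.pDiv_one_iff_exists_zsmul_eq hK d₁ P₀ hP₀K 2 M₀ (htor1 M₀)).mp hdiv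
  have hndivK : ¬ ∃ Q : (W.baseChange K).toAffine.Point, ((2 ^ (M₀ + 1) : ℕ) : ℤ) • Q = P₀ :=
    fun h ↦ hndiv ((X11b.Three.Koly.pDiv_one_iff_exists_zsmul_eq hK d₁ P₀ hP₀K 2 (M₀ + 1) (htor1 (M₀ + 1))).mpr h)
  haveI : Finite (AddCommGroup.torsion (W.baseChange K).toAffine.Point) :=
    WeierstrassCurve.finite_torsion_point (W := W.baseChange K)
  obtain ⟨cc, Q, hcQ, hcker⟩ := X11b.RankOne.exists_coord_of_mordellWeilRank_eq_one (W.baseChange K) hrkK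
  have hidx : padicValNat 2 (AddSubgroup.zmultiples P₀).index = M₀ :=
    X11b.Three.Koly.padicValNat_index_zmultiples_eq_of_divisibility (p := 2) cc Q hcQ hcker hiv P₀ hdivK hndivK
  set I := (AddSubgroup.zmultiples P₀).index with hI_def
  have hI0 : I ≠ 0 := fun hI ↦ by
    have hh := P2.torsionOrder_sq_mul_canonicalHeight_eq_index_sq_mul_regulator (W.baseChange K) hrkK P₀ hPinf
    rw [← hI_def, hI, Nat.cast_zero, zero_pow two_ne_zero, zero_mul, mul_eq_zero, pow_eq_zero_iff two_ne_zero,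
      Nat.cast_eq_zero] at hh
    exact hh.elim (W.baseChange K).torsionOrder_pos_holds.ne'
      (fun h0 ↦ hPinf ((Affine.Point.canonicalHeight_eq_zero_iff_holds P₀).mp h0))
  set q : ℚ := 4 * (I : ℚ) ^ 2 /
      ((Dt.c : ℚ) ^ 2 * (Units.torsionOrder K : ℚ) ^ 2 * ((W.tamagawaProduct : ℚ) ^ 2)) with hq_def
  have hcQ0 : (Dt.c : ℚ) ≠ 0 := by exact_mod_cast hc0
  have hcW0 : (W.tamagawaProduct : ℚ) ≠ 0 := by exact_mod_cast W.tamagawaProduct_pos_holds.ne'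
  have hIQ0 : (I : ℚ) ≠ 0 := by exact_mod_cast hI0
  have hq' : q = ((I : ℚ) / ((Dt.c : ℚ) * (W.tamagawaProduct : ℚ))) ^ 2 := by
    rw [hq_def, hw2]
    push_cast
    field_simp
    ring
  have hvc : padicValRat 2 (Dt.c : ℚ) = padicValInt 2 Dt.c := padicValRat.of_int
  have hval : padicValRat 2 q = 2 * (M₀ : ℤ) - 2 * (padicValInt 2 Dt.c : ℤ) - 2 * (padicValNat 2 W.tamagawaProduct : ℤ) := by
    rw [hq', padicValRat.pow, padicValRat.div hIQ0 (mul_ne_zero hcQ0 hcW0),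
      padicValRat.mul hcQ0 hcW0, hvc, padicValRat.of_nat, padicValRat.of_nat, hidx]
    push_cast
    ring
  have hshaV : padicValNat 2 (W.baseChange K).shaOrder = 0 := by
    rw [X11b.Three.Koly.padicValNat_shaOrder_eq (W.baseChange K) 2, hsha]
    simp
  exact ⟨hrd, hrK, hShaK, hshaV, q, hshaC, hval⟩

/-! ## §1 The `ε = −1` descent at depth `M₀ = ord₂ c + ord₂ C(E)` -/

/-- **THE DEPTH-`(ord₂ c + ord₂ C(E))` SWAPPED DESCENT, MODULO ITS FOUR PUBLISHED INPUTS** `hGZ` (Gross–Zagier, all `(N, W, K)`), `hGZK`, `hmod`,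
`hMilneC`.  For the rank-ONE `2`-Selmer-minimal member `E` (`r_an(E) = 1`, `#Sel₂(E) = 2`, **`Δ_E < 0`, any `C(E)`**), a Heegner field `K` (`d_K`
odd `≠ −3`), ANY datum `Dt` (`c ≠ 0`, Manin-free), `P(1)` of infinite order with **`2^(ord₂ c + ord₂ C(E)) ∥ P(1)` in `E(K[1])`**, and a globally
minimal `2`-Selmer-TRIVIAL twin `Wd ≅ E^(d_K)` with **`ord₂ C(Wd) ≤ ord₂ C(E) + 1`**: **`BSD₂(Wd) → BSD₂(E)`**.  Inside (§0): `Ш(E/K)[2^∞] = 0`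
unconditionally, `ord₂ #Ш_an(E_K) = 0 = ord₂ #Ш(E_K)`, i.e. `MissingPPartOverCAt (W ⊗ K) 2`; `r_an(Wd) = 0`; then
`AdditivePotMult.bsdp_of_pPartOverC_baseChange`.  At `C(E)` odd = g23's S3′/S3″ on `Δ < 0`; at `ord₂ C(E) = 1`, `c` odd = the engine for the
cell `hTw1` of `closes` with the witness «`2 ∣ y_K`, `4 ∤ y_K`».  CONDITIONAL on the four named facts; closes nothing by itself.
[cite: GrossZagier1986, V.§2 (pp. 310–312)] [cite: GrossLMS1991, §5 Prop. 5.3] [cite: Milne1972ArithmeticAV, §1 Thm. 1]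
[cite: McCallumLMS1991, §5 Lemma 5.1] [cite: Kramer1981, Thm. 1] [cite: Miller2011LMS, Def. 1.1] -/
theorem swappedPairDescentAtTwo_tamagawaDepth_of_facts
    (hGZ : ∀ (N : ℕ) [NeZero N] (W : WeierstrassCurve ℚ) (K : Type) [Field K] [NumberField K],
      gross_zagier N W K)
    (hGZK : rank_eq_analyticRank_of_analyticRank_le_one) (hmod : hasEntireLFunction_rat)
    (hMilneC : Milne1972.bsdQuotient_baseChange_quadratic_anyModel) :
    ∀ (W : WeierstrassCurve ℚ) [W.IsElliptic] [W.IsGloballyMinimal] [NeZero (W.conductorNorm ℤ)],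
      W.analyticRank = 1 → Nat.card (W.selmerGroup 2) = 2 → W.Δ < 0 →
      ∀ (K : Type) [Field K] [NumberField K], IsImaginaryQuadratic K → Odd (NumberField.discr K) →
      NumberField.discr K ≠ -3 → SatisfiesHeegnerHypothesis (W.conductorNorm ℤ) K →
      ∀ (Dt : ModularParametrizationData W (W.conductorNorm ℤ)), Dt.c ≠ 0 →
      ∀ (β : ℤ) (ι : K →+* ℂ) (d₁ : KolyvaginHeegnerData Dt β ι 1), ¬ IsOfFinAddOrder d₁.derivedPoint →
        (∃ Q : (W.baseChange (ringClassField K ι 1)).toAffine.Point,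
          ((2 ^ (padicValInt 2 Dt.c + padicValNat 2 W.tamagawaProduct) : ℕ) : ℤ) • Q = d₁.derivedPoint) →
        (¬ ∃ Q : (W.baseChange (ringClassField K ι 1)).toAffine.Point,
          ((2 ^ (padicValInt 2 Dt.c + padicValNat 2 W.tamagawaProduct + 1) : ℕ) : ℤ) • Q = d₁.derivedPoint) →
      ∀ (Wd : WeierstrassCurve ℚ) [Wd.IsElliptic] [Wd.IsGloballyMinimal],
        (∃ C : WeierstrassCurve.VariableChange ℚ, C • W.quadraticTwist (NumberField.discr K : ℚ) = Wd) →
        Nat.card (Wd.selmerGroup 2) = 1 →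
        padicValNat 2 Wd.tamagawaProduct ≤ padicValNat 2 W.tamagawaProduct + 1 →
        BSDp Wd 2 → BSDp W 2 := by
  intro W _ _ _ hr hSel hΔ K _ _ hK hodd h3 hH Dt hc0 β ι d₁ hy hdiv hndiv Wd _ _ hWd hSel1 hDEF hBd
  haveI hEK : (W.baseChange K).IsElliptic := isElliptic_baseChange' W K
  have h2 : Module.finrank ℚ K = 2 := hK.1
  obtain ⟨Cd, hCd⟩ := hWd
  obtain ⟨hrd, -, hShaK, hshaV, q, hshaC, hval⟩ := padicValRat_shaAn_and_shaOrder_of_swappedPair_of_le_succ W K (hGZ _ W K) hGZK hmod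
    hr hSel hΔ hK hodd h3 hH Dt hc0 β ι d₁ hy hdiv hndiv Wd Cd hCd hSel1 hDEF
  haveI : Finite (W.baseChange K).sha := hShaK
  have hKin : MissingPPartOverCAt (W.baseChange K) 2 := ⟨q, hshaC, by rw [hval, hshaV]; push_cast; ring⟩
  exact bsdp_of_pPartOverC_baseChange W 2 K Wd hGZK hmod hMilneC hr.le h2 ⟨Cd, hCd⟩
    (by rw [hrd]; exact zero_le_one) hKin hBd

/-- **The bundled `…OfFacts` shape** of §1 (the cell's convention, as `ExactDescentAtTwoOfFourFacts` 24238 and g23's S3′).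
[cite: Miller2011LMS, Def. 1.1] -/
theorem swappedPairDescentAtTwo_tamagawaDepth_ofFacts :
    ((∀ (N : ℕ) [NeZero N] (W : WeierstrassCurve ℚ) (K : Type) [Field K] [NumberField K],
        gross_zagier N W K) ∧
      rank_eq_analyticRank_of_analyticRank_le_one ∧ hasEntireLFunction_rat ∧
      Milne1972.bsdQuotient_baseChange_quadratic_anyModel) →
    ∀ (W : WeierstrassCurve ℚ) [W.IsElliptic] [W.IsGloballyMinimal] [NeZero (W.conductorNorm ℤ)],
      W.analyticRank = 1 → Nat.card (W.selmerGroup 2) = 2 → W.Δ < 0 →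
      ∀ (K : Type) [Field K] [NumberField K], IsImaginaryQuadratic K → Odd (NumberField.discr K) →
      NumberField.discr K ≠ -3 → SatisfiesHeegnerHypothesis (W.conductorNorm ℤ) K →
      ∀ (Dt : ModularParametrizationData W (W.conductorNorm ℤ)), Dt.c ≠ 0 →
      ∀ (β : ℤ) (ι : K →+* ℂ) (d₁ : KolyvaginHeegnerData Dt β ι 1), ¬ IsOfFinAddOrder d₁.derivedPoint →
        (∃ Q : (W.baseChange (ringClassField K ι 1)).toAffine.Point,
          ((2 ^ (padicValInt 2 Dt.c + padicValNat 2 W.tamagawaProduct) : ℕ) : ℤ) • Q = d₁.derivedPoint) →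
        (¬ ∃ Q : (W.baseChange (ringClassField K ι 1)).toAffine.Point,
          ((2 ^ (padicValInt 2 Dt.c + padicValNat 2 W.tamagawaProduct + 1) : ℕ) : ℤ) • Q = d₁.derivedPoint) →
      ∀ (Wd : WeierstrassCurve ℚ) [Wd.IsElliptic] [Wd.IsGloballyMinimal],
        (∃ C : WeierstrassCurve.VariableChange ℚ, C • W.quadraticTwist (NumberField.discr K : ℚ) = Wd) →
        Nat.card (Wd.selmerGroup 2) = 1 →
        padicValNat 2 Wd.tamagawaProduct ≤ padicValNat 2 W.tamagawaProduct + 1 →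
        BSDp Wd 2 → BSDp W 2 :=
  fun h ↦ swappedPairDescentAtTwo_tamagawaDepth_of_facts h.1 h.2.1 h.2.2.1 h.2.2.2

/-! ## §2 Losslessness: the BSD pair forces the depth `M₀ = ord₂ c + ord₂ C(E)` -/

/-- **`BSD₂(E) ∧ BSD₂(Wd)` + PRINT force `M₀ = ord₂ c + ord₂ C(E)`** on the one-bit swapped frame of §0 with ANY exact exponent `2^(M₀) ∥ P(1)`:
the exactness-on-the-canonical-model iff `AdditivePotMult.missingPPartOverCAt_baseChange_iff_bsdp` (`.mpr`) turns the two `BSD₂` into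
`ord₂ #Ш_an(E_K) = ord₂ #Ш(E_K) = 0` (§0), while `ord₂ #Ш_an(E_K) = 2 M₀ − 2 ord₂ c − 2 ord₂ C(E)` (§0).  CONDITIONAL on the two `BSD₂` hypotheses
and the four named facts; a losslessness statement, nothing about BSD is proved.
[cite: GrossZagier1986, V.§2 (2.2)] [cite: Milne1972ArithmeticAV, §1 Thm. 1] [cite: McCallumLMS1991, §5 Lemma 5.1] [cite: Miller2011LMS, Def. 1.1] -/
theorem twoDivExponent_eq_padicValNat_tamagawa_of_bsdp
    (W : WeierstrassCurve ℚ) [W.IsElliptic] [W.IsGloballyMinimal] [NeZero (W.conductorNorm ℤ)]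
    (K : Type) [Field K] [NumberField K]
    (hGZ : gross_zagier (W.conductorNorm ℤ) W K) (hGZK : rank_eq_analyticRank_of_analyticRank_le_one)
    (hmod : hasEntireLFunction_rat) (hMilneC : Milne1972.bsdQuotient_baseChange_quadratic_anyModel)
    (hr : W.analyticRank = 1) (hSel : Nat.card (W.selmerGroup 2) = 2) (hΔ : W.Δ < 0)
    (hK : IsImaginaryQuadratic K) (hodd : Odd (NumberField.discr K)) (h3 : NumberField.discr K ≠ -3)
    (hH : SatisfiesHeegnerHypothesis (W.conductorNorm ℤ) K)
    (Dt : ModularParametrizationData W (W.conductorNorm ℤ)) (hc0 : Dt.c ≠ 0) (β : ℤ) (ι : K →+* ℂ)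
    (d₁ : KolyvaginHeegnerData Dt β ι 1) (hy : ¬ IsOfFinAddOrder d₁.derivedPoint) {M₀ : ℕ}
    (hdiv : ∃ Q : (W.baseChange (ringClassField K ι 1)).toAffine.Point, ((2 ^ M₀ : ℕ) : ℤ) • Q = d₁.derivedPoint)
    (hndiv : ¬ ∃ Q : (W.baseChange (ringClassField K ι 1)).toAffine.Point, ((2 ^ (M₀ + 1) : ℕ) : ℤ) • Q = d₁.derivedPoint)
    (Wd : WeierstrassCurve ℚ) [Wd.IsElliptic] [Wd.IsGloballyMinimal]
    (hWd : ∃ C : VariableChange ℚ, C • W.quadraticTwist (NumberField.discr K : ℚ) = Wd)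
    (hSel1 : Nat.card (Wd.selmerGroup 2) = 1)
    (hDEF : padicValNat 2 Wd.tamagawaProduct ≤ padicValNat 2 W.tamagawaProduct + 1)
    (hBW : BSDp W 2) (hBd : BSDp Wd 2) :
    M₀ = padicValInt 2 Dt.c + padicValNat 2 W.tamagawaProduct := by
  haveI hEK : (W.baseChange K).IsElliptic := isElliptic_baseChange' W K
  have h2 : Module.finrank ℚ K = 2 := hK.1
  obtain ⟨Cd, hCd⟩ := hWd
  obtain ⟨hrd, -, hShaK, hshaV, q, hshaC, hval⟩ := padicValRat_shaAn_and_shaOrder_of_swappedPair_of_le_succ W K hGZ hGZK hmod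
    hr hSel hΔ hK hodd h3 hH Dt hc0 β ι d₁ hy hdiv hndiv Wd Cd hCd hSel1 hDEF
  haveI : Finite (W.baseChange K).sha := hShaK
  obtain ⟨q', hq', hv'⟩ :=
    (missingPPartOverCAt_baseChange_iff_bsdp W 2 K Wd hGZK hmod hMilneC (by rw [hr]) h2 ⟨Cd, hCd⟩
      (by rw [hrd]; exact zero_le_one) hBd).mpr hBW
  have hqq : q' = q := Rat.cast_injective (α := ℂ) (hq'.symm.trans hshaC)
  rw [hqq, hval, hshaV] at hv'
  have h : (2 : ℤ) * (M₀ : ℤ) - 2 * (padicValInt 2 Dt.c : ℤ) - 2 * (padicValNat 2 W.tamagawaProduct : ℤ) = 0 := by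
    exact_mod_cast hv'
  omega

/-- **From the LEAF** (route currency): `NonCMAtTwo` + the route's four PRINT items (`GrossZagierAllLevels`, `EntireLFunctionRat`,
`MultPublishedInputsAtTwo`, `MilneAnyModel`) force `M₀ = ord₂ c + ord₂ C(E)` on every one-bit swapped frame of a non-CM `E` (`BSD₂(E)`: `E` of analytic
rank `1`; `BSD₂(Wd)`: the twin is non-CM — same `j` — of analytic rank `0`).  On the cell `hTw1` (`Δ < 0`, `ord₂ C(E) = 1`) the exponent clause of the
reversed supply S2⁻ (depth one for an odd-Manin datum) therefore carries no slack.  CONDITIONAL on the leaf; BSD is NOT proved by this.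
[cite: GrossZagier1986, V.§2 (2.2)] [cite: Milne1972ArithmeticAV, §1 Thm. 1] [cite: Miller2011LMS, Def. 1.1] -/
theorem twoDivExponent_eq_padicValNat_tamagawa_of_nonCMAtTwo
    (hleaf : Summit.BirchSwinnertonDyer.BirchSwinnertonDyer.Rank1Residual.NonCMAtTwo)
    (hGZ : ∀ (N : ℕ) [NeZero N] (W : WeierstrassCurve ℚ) (K : Type) [Field K] [NumberField K], gross_zagier N W K)
    (hL : hasEntireLFunction_rat) (hGZK : rank_eq_analyticRank_of_analyticRank_le_one)
    (hMi : Milne1972.bsdQuotient_baseChange_quadratic_anyModel)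
    (W : WeierstrassCurve ℚ) [W.IsElliptic] [W.IsGloballyMinimal] [NeZero (W.conductorNorm ℤ)]
    (hcm : ¬ W.HasCM) (hr : W.analyticRank = 1) (hSel : Nat.card (W.selmerGroup 2) = 2) (hΔ : W.Δ < 0)
    (K : Type) [Field K] [NumberField K] (hK : IsImaginaryQuadratic K) (hodd : Odd (NumberField.discr K))
    (h3 : NumberField.discr K ≠ -3) (hH : SatisfiesHeegnerHypothesis (W.conductorNorm ℤ) K)
    (Dt : ModularParametrizationData W (W.conductorNorm ℤ)) (hc0 : Dt.c ≠ 0) (β : ℤ) (ι : K →+* ℂ)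
    (d₁ : KolyvaginHeegnerData Dt β ι 1) (hy : ¬ IsOfFinAddOrder d₁.derivedPoint) {M₀ : ℕ}
    (hdiv : ∃ Q : (W.baseChange (ringClassField K ι 1)).toAffine.Point, ((2 ^ M₀ : ℕ) : ℤ) • Q = d₁.derivedPoint)
    (hndiv : ¬ ∃ Q : (W.baseChange (ringClassField K ι 1)).toAffine.Point, ((2 ^ (M₀ + 1) : ℕ) : ℤ) • Q = d₁.derivedPoint)
    (Wd : WeierstrassCurve ℚ) [Wd.IsElliptic] [Wd.IsGloballyMinimal]
    (hWd : ∃ C : VariableChange ℚ, C • W.quadraticTwist (NumberField.discr K : ℚ) = Wd)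
    (hSel1 : Nat.card (Wd.selmerGroup 2) = 1)
    (hDEF : padicValNat 2 Wd.tamagawaProduct ≤ padicValNat 2 W.tamagawaProduct + 1) :
    M₀ = padicValInt 2 Dt.c + padicValNat 2 W.tamagawaProduct := by
  haveI hEK : (W.baseChange K).IsElliptic := isElliptic_baseChange' W K
  have hD0 : (NumberField.discr K : ℚ) ≠ 0 := by exact_mod_cast NumberField.discr_ne_zero K
  haveI hEt : (W.quadraticTwist (NumberField.discr K : ℚ)).IsElliptic := W.isElliptic_quadraticTwist hD0
  obtain ⟨Cd, hCd⟩ := hWd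
  have hBW : BSDp W 2 := hleaf W hcm (by rw [hr])
  have hcmd : ¬ Wd.HasCM := by
    rw [← hCd, hasCM_iff_of_j_eq (((W.quadraticTwist (NumberField.discr K : ℚ)).variableChange_j Cd).trans (W.j_quadraticTwist hD0))]
    exact hcm
  obtain ⟨hrd, -⟩ := padicValRat_shaAn_and_shaOrder_of_swappedPair_of_le_succ W K (hGZ _ W K) hGZK hL
    hr hSel hΔ hK hodd h3 hH Dt hc0 β ι d₁ hy hdiv hndiv Wd Cd hCd hSel1 hDEF
  have hBd : BSDp Wd 2 := hleaf Wd hcmd (by rw [hrd]; exact zero_le_one)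
  exact twoDivExponent_eq_padicValNat_tamagawa_of_bsdp W K (hGZ _ W K) hGZK hL hMi hr hSel hΔ hK hodd h3 hH Dt hc0 β ι d₁ hy hdiv
    hndiv Wd ⟨Cd, hCd⟩ hSel1 hDEF hBW hBd


/-! ## §3 Census composition: the cell `hTw1` from the rank-`0` wall, the reversed depth-one supply S2⁻ and PRINT -/

/-- **`hTw1 ⟸ S1 + S2⁻ + PRINT` (pure logic over §1).**  With
`hS1` — LINE 23's anchor S1 (`MinimalRankZeroBSDTwo`, pen v1.1 text verbatim: `BSD₂` for non-CM curves of analytic rank `0` with trivial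
`2`-Selmer group; the `#Sel₂ = 1` slice of WALL row 1),
`hS2m` — S2⁻, the REVERSED `2`-Selmer-trivial Heegner twin supply at depth one on the cell (for `W` non-CM, `r_an = 1`, `#Sel₂ = 2`, `Δ < 0`,
`ord₂ C(W) = 1`: some Heegner field `K` with `d_K` odd `≠ −3`, a datum `Dt` with `c ≠ 0`, a conductor-`1` datum with `P(1)` of infinite order and
`2^(ord₂ c + 1) ∥ P(1)` in `E(K[1])`, and a globally minimal twin `Wd ≅ E^(d_K)` with `#Sel₂(Wd) = 1` and `ord₂ C(Wd) ≤ 2`),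
and the four PRINT items, **every `W` on the cell `hTw1 = (Δ < 0, ord₂ C = 1)` of `…TamagawaSlices` satisfies `BSD₂`** — the binder `hTw1`
of `Slices.nonCMAtTwo_of_items_of_tamagawaSlicedTwin` verbatim.  The twin's `r_an = 0` and non-CM are derived (§0; same `j`).  CONDITIONAL on
the displayed hypotheses (S1 is the rank-`0` wall, S2⁻ is beyond print as a supply statement); BSD is NOT proved; nothing is closed.
[cite: GrossZagier1986, V.§2 (2.2)] [cite: Milne1972ArithmeticAV, §1 Thm. 1] [cite: Miller2011LMS, Def. 1.1] -/
theorem hTw1_of_wall_of_reversedSupplyDepthOne_of_facts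
    (hGZ : ∀ (N : ℕ) [NeZero N] (W : WeierstrassCurve ℚ) (K : Type) [Field K] [NumberField K], gross_zagier N W K)
    (hGZK : rank_eq_analyticRank_of_analyticRank_le_one) (hmod : hasEntireLFunction_rat)
    (hMilneC : Milne1972.bsdQuotient_baseChange_quadratic_anyModel)
    (hS1 : ∀ (W : WeierstrassCurve ℚ) [W.IsElliptic] [W.IsGloballyMinimal],
      ¬ W.HasCM → W.analyticRank = 0 → Nat.card (W.selmerGroup 2) = 1 → BSDp W 2)
    (hS2m : ∀ (W : WeierstrassCurve ℚ) [W.IsElliptic] [W.IsGloballyMinimal] [NeZero (W.conductorNorm ℤ)],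
      ¬ W.HasCM → W.analyticRank = 1 → Nat.card (W.selmerGroup 2) = 2 → W.Δ < 0 → padicValNat 2 W.tamagawaProduct = 1 →
      ∃ (K : Type) (_ : Field K) (_ : NumberField K),
        IsImaginaryQuadratic K ∧ Odd (NumberField.discr K) ∧ NumberField.discr K ≠ -3 ∧
        SatisfiesHeegnerHypothesis (W.conductorNorm ℤ) K ∧
        ∃ (Dt : ModularParametrizationData W (W.conductorNorm ℤ)) (β : ℤ) (ι : K →+* ℂ) (d₁ : KolyvaginHeegnerData Dt β ι 1),
          Dt.c ≠ 0 ∧ ¬ IsOfFinAddOrder d₁.derivedPoint ∧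
          (∃ Q : (W.baseChange (ringClassField K ι 1)).toAffine.Point,
            ((2 ^ (padicValInt 2 Dt.c + 1) : ℕ) : ℤ) • Q = d₁.derivedPoint) ∧
          (¬ ∃ Q : (W.baseChange (ringClassField K ι 1)).toAffine.Point,
            ((2 ^ (padicValInt 2 Dt.c + 1 + 1) : ℕ) : ℤ) • Q = d₁.derivedPoint) ∧
          ∃ (Wd : WeierstrassCurve ℚ) (_ : Wd.IsElliptic) (_ : Wd.IsGloballyMinimal),
            (∃ C : WeierstrassCurve.VariableChange ℚ, C • W.quadraticTwist (NumberField.discr K : ℚ) = Wd) ∧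
            Nat.card (Wd.selmerGroup 2) = 1 ∧ padicValNat 2 Wd.tamagawaProduct ≤ 2) :
    ∀ (W : WeierstrassCurve ℚ) [W.IsElliptic] [W.IsGloballyMinimal], ¬ W.HasCM → W.analyticRank = 1 →
      Nat.card (W.selmerGroup 2) = 2 → W.Δ < 0 → padicValNat 2 W.tamagawaProduct = 1 → BSDp W 2 := by
  intro W _ _ hcm hr hSel hΔ hC1
  haveI : NeZero (W.conductorNorm ℤ) := ⟨(W.conductorNorm_pos_holds).ne'⟩
  obtain ⟨K, iF, iN, hK, hodd, h3, hH, Dt, β, ι, d₁, hc0, hy, hdiv, hndiv, Wd, iE, iM, hWd, hSel1, hDEF2⟩ :=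
    hS2m W hcm hr hSel hΔ hC1
  haveI hEK : (W.baseChange K).IsElliptic := isElliptic_baseChange' W K
  have hD0 : (NumberField.discr K : ℚ) ≠ 0 := by exact_mod_cast NumberField.discr_ne_zero K
  haveI hEt : (W.quadraticTwist (NumberField.discr K : ℚ)).IsElliptic := W.isElliptic_quadraticTwist hD0
  obtain ⟨Cd, hCd⟩ := hWd
  have hDEF : padicValNat 2 Wd.tamagawaProduct ≤ padicValNat 2 W.tamagawaProduct + 1 := by rw [hC1]; exact hDEF2
  have hdiv' : ∃ Q : (W.baseChange (ringClassField K ι 1)).toAffine.Point,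
      ((2 ^ (padicValInt 2 Dt.c + padicValNat 2 W.tamagawaProduct) : ℕ) : ℤ) • Q = d₁.derivedPoint := by rw [hC1]; exact hdiv
  have hndiv' : ¬ ∃ Q : (W.baseChange (ringClassField K ι 1)).toAffine.Point,
      ((2 ^ (padicValInt 2 Dt.c + padicValNat 2 W.tamagawaProduct + 1) : ℕ) : ℤ) • Q = d₁.derivedPoint := by rw [hC1]; exact hndiv
  -- the twin is non-CM (same `j`) of analytic rank `0`: `BSD₂(Wd)` from S1
  have hcmd : ¬ Wd.HasCM := by
    rw [← hCd, hasCM_iff_of_j_eq (((W.quadraticTwist (NumberField.discr K : ℚ)).variableChange_j Cd).trans (W.j_quadraticTwist hD0))]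
    exact hcm
  obtain ⟨hrd, -⟩ := padicValRat_shaAn_and_shaOrder_of_swappedPair_of_le_succ W K (hGZ _ W K) hGZK hmod hr hSel hΔ hK hodd h3 hH Dt
    hc0 β ι d₁ hy hdiv' hndiv' Wd Cd hCd hSel1 hDEF
  have hBd : BSDp Wd 2 := hS1 Wd hcmd hrd hSel1
  exact swappedPairDescentAtTwo_tamagawaDepth_of_facts hGZ hGZK hmod hMilneC W hr hSel hΔ K hK hodd h3 hH Dt hc0 β ι d₁ hy hdiv' hndiv'
    Wd ⟨Cd, hCd⟩ hSel1 hDEF hBd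

end Summit.BirchSwinnertonDyer.BirchSwinnertonDyer.Theorems.GenusExact.TwinSwap.OneBit

end
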